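import Summits.BirchSwinnertonDyer.BirchSwinnertonDyer.Theses.SignedBalanceX9
import Summits.BirchSwinnertonDyer.BirchSwinnertonDyer.Theorems.BiquadraticEisensteinDescentHeegnerFieldSupplyEvenRung
import Summits.BirchSwinnertonDyer.BirchSwinnertonDyer.Theorems.SignedBalanceX9TwistedAnalyticMuZeroCoprimeX9StubTwistSideDiscriminantX9
import Summits.BirchSwinnertonDyer.Rank1Residual.X9.TwistStability
import Literature.NumberTheory.EllipticCurves.HeegnerPointsImaginaryQuadraticProofs
import Literature.NumberTheory.QuadraticFields.DedekindZetaReducedForms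
import Literature.NumberTheory.QuadraticFields.FundamentalDiscriminant
import Literature.NumberTheory.QuadraticFields.KroneckerSplitting
import HarnessLib

/-!
# Route `SignedBalanceX9`, crux `TwistedAnalyticMuZeroCoprimeX9` (item stmt-BirchSwinnertonDyer-25216),
# line «coprime class-number frames»: the stubs (K) and (U) of the registered skeleton, REDUCED TO PRINT
# and to the route's own analytic crux

Lead prover seat `bsd-line-sbx9-p1` (D-0154 KEY (148)(d)), cell `pub/bsd-print-x9`. THEOREMS ONLY (no definition,
no named fact, no `sorry`). The registered skeleton (bsd-idea-2 g3, sha 3583344c0151385b) composes the crux from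
three stubs (F) `stub_twistSideDiscriminantX9`, (K) `stub_coprimeSplitDiscriminantSupply`, (U)
`stub_unitCoeffOfCoprimeTwistX9`. This file proves:

* §1 `splitsInQuadField_discr_of_ncard_eq_two`, `splitsInQuadField_two_of_emod_eight` — the decomposition law read
  into the route's predicate `SplitsInQuadField` (two primes of `𝓞 K` above an odd `ℓ` ⇒ `ℓ ∤ d_K` and `d_K` a
  square mod `ℓ`; `d_K ≡ 1 (mod 8)` ⇒ `2` split), from the tree's `Quadratic.ncard_primesOver_eq_two_iff_legendreSym`.
* §2 **(K) GRANTED Beckwith–Raum–Richter 2022 Thm. 1** —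
  `coprimeSplitDiscriminantSupply_of_brr2022 : BRR2022_thm_1 → Stmt(K)` VERBATIM: for a prime `p ≥ 5` and
  `M > 0` an odd fundamental `d_K < 0`, `d_K ≠ -3`
  (indeed `d_K ≡ 1 (mod 8)`), every prime `ℓ ∣ M` and `p` split, and `p ∤ h_K` for EVERY imaginary quadratic
  field of discriminant `d_K`. The 2-adic case («print gap» of the item: `2 ∣ M` needs `d_K ≡ 1 (mod 8)`, outside
  Beckwith–Raum–Richter IMRN 2024 Thm. 1 / Wiles 2015 whose split sets are ODD) is exactly the landed kernel
  theorem `BiquadraticEisensteinDescentHeegnerFieldSupplyEvenRung.exists_twoSplit_split_not_dvd_classNumber`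
  (route BED, supply crux KS_R; Hurwitz class numbers `H(an+b)` on `8 ∣ a`, Cox Thm. 7.24), CONDITIONAL on the
  named fact `Literature.NumberTheory.QuadraticFields.BRR2022_thm_1` (Adv. Math. 409 (2022) 108663, Thm. 1) only.
* §3 **(U) from the route's analytic crux `AnalyticMuZeroX9` (item 19630) and modularity** —
  `unitCoeffOfCoprimeTwistX9_of_analyticMuZero : AnalyticMuZeroOnClassX9 → exists_isNewformOf → Stmt(U)`
  VERBATIM: a prime-to-`p` square-free twist of an X9 pair has a globally minimal model which is an X9 pair
  again (`X9.ClassX9.exists_twist`: Néron model `hasGlobalMinimalModel_rat_holds` + twist stability), a newform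
  (modularity), hence a unit coefficient by Greenberg's analytic `μ = 0` ON CLASS X9 — the binder `hMu` that the
  route's `closes` ALREADY carries. So (U) adds no open content beyond item 19630.

* §4 **the composition** `twistedAnalyticMuZeroCoprimeX9_of_twistSide : (F) → BRR2022_thm_1 → AnalyticMuZeroOnClassX9 →
  exists_isNewformOf → TwistedAnalyticMuZeroCoprimeX9` (the route decl BY NAME; (F) = the registered real-quadratic stub,
  Dirichlet/CRT, landed by the line's second seat as `SignedBalanceX9CoprimeFrame.stub_twistSideDiscriminantX9`, p606505),
  and **`twistedAnalyticMuZeroCoprimeX9_of_print : BRR2022_thm_1 → AnalyticMuZeroOnClassX9 → exists_isNewformOf →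
  TwistedAnalyticMuZeroCoprimeX9`** — the crux by name from two PRINT facts and the route's crux 19630.

Honest status: (K) conditional on ONE print fact; (U) conditional on the OPEN class statement
`AnalyticMuZeroOnClassX9` (Greenberg, LNM 1716, Conj. 1.11) + the Modularity Theorem (`exists_isNewformOf`);
no summit, leaf or crux is proved by this file; BSD is not proved.

References: [BeckwithRaumRichter2022] Adv. Math. 409 (2022), Thm. 1; [Cox2013] Thm. 7.24, Thm. 7.7 (ii);
[BurungaleCastellaSkinner2025] §1.2, Prop. 5.2.1, Lemma 5.2.3; [GreenbergLNM1716] Conj. 1.11;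
[DiamondShurman2005] Thm. 8.8.3; [SilvermanAEC2009] VIII.8.3, X.5.4; [Marcus2018] Ch. 3 Thm. 25.
-/

set_option linter.dupNamespace false
set_option autoImplicit false

noncomputable section

open scoped Classical NumberField

open Module NumberField WeierstrassCurve
open Literature.NumberTheory.EllipticCurves Literature.NumberTheory.EllipticCurves.ModularForms
open Literature.NumberTheory.QuadraticFields (BRR2022_thm_1)
open Literature.NumberTheory.QuadraticFields.Quadratic
open Summit.BirchSwinnertonDyer.BirchSwinnertonDyer.Rank1Residual
open Summit.BirchSwinnertonDyer.BirchSwinnertonDyer.Theorems.BiquadraticEisensteinDescentHeegnerFieldSupplyEvenRung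
  (exists_twoSplit_split_not_dvd_classNumber)

namespace Summit.BirchSwinnertonDyer.BirchSwinnertonDyer.Theorems.SignedBalanceX9CoprimeFrame

/-! ## §1 The decomposition law, read into `SplitsInQuadField` -/

/-- For a quadratic field `K` and an odd prime `ℓ`: if there are two primes of `𝓞 K` above `ℓ` then `ℓ`
splits in `ℚ(√d_K)` in the route's Kronecker currency (`ℓ ∤ d_K`, `d_K` a square mod `ℓ`).
[cite: Marcus2018, Ch. 3 Thm. 25] -/
theorem splitsInQuadField_discr_of_ncard_eq_two {K : Type*} [Field K] [NumberField K]
    (h2 : finrank ℚ K = 2) {ℓ : ℕ} (hℓ : ℓ.Prime) (hℓ2 : ℓ ≠ 2)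
    (h : ((Ideal.span {(ℓ : ℤ)}).primesOver (𝓞 K)).ncard = 2) :
    SplitsInQuadField (NumberField.discr K) ℓ := by
  haveI := Fact.mk hℓ
  have h1 : legendreSym ℓ (NumberField.discr K) = 1 :=
    (ncard_primesOver_eq_two_iff_legendreSym h2 hℓ2).mp h
  have h0 : ((NumberField.discr K : ℤ) : ZMod ℓ) ≠ 0 := fun h0 => by
    rw [(legendreSym.eq_zero_iff ℓ _).mpr h0] at h1
    exact zero_ne_one h1
  refine ⟨fun hdvd => h0 ((ZMod.intCast_zmod_eq_zero_iff_dvd _ ℓ).mpr hdvd), fun h => absurd h hℓ2,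
    fun _ => (legendreSym.eq_one_iff ℓ h0).mp h1⟩

/-- `d ≡ 1 (mod 8)` ⇒ `2` splits in `ℚ(√d)` (Kronecker currency). [cite: Marcus2018, Ch. 3 Thm. 25] -/
theorem splitsInQuadField_two_of_emod_eight {d : ℤ} (h8 : d % 8 = 1) : SplitsInQuadField d 2 :=
  ⟨fun h => by omega, fun _ => h8, fun h => absurd rfl h⟩

/-! ## §2 Stub (K), granted Beckwith–Raum–Richter 2022, Theorem 1 -/

/-- **Stub (K) of the coprime-frame skeleton, CONDITIONAL on `BRR2022_thm_1`** (signature = the registered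
`Stmt.stub_coprimeSplitDiscriminantSupply` verbatim after the hypothesis `h22`): for a prime `p ≥ 5` and
`M > 0` there is `d_K < 0`, square-free, `d_K ≡ 1 (mod 4)`, `d_K ≠ -3`, with every prime `ℓ ∣ M` and `p`
split in `ℚ(√d_K)` and `p ∤ h_K` for every imaginary quadratic field `K` of discriminant `d_K`. Proof: the
kernel theorem `exists_twoSplit_split_not_dvd_classNumber` (ℓ := p, S := odd prime factors of `M` ∪ {p})
gives a field with `d_K ≡ 1 (mod 8)`; its discriminant is fundamental (`isFundamentalDiscriminant_discr`),
hence square-free; splitting by §1; the class number of any field with the same discriminant is the same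
form count `h(d_K)` (`card_reducedForms_eq_classNumber`, Cox Thm. 7.7 (ii)).
[cite: BeckwithRaumRichter2022, Theorem 1] [cite: Cox2013, §7.B Thm. 7.7 (ii), §7.D Thm. 7.24] -/
theorem coprimeSplitDiscriminantSupply_of_brr2022 (h22 : BRR2022_thm_1) :
    ∀ (p : ℕ) [Fact p.Prime] (M : ℕ), 5 ≤ p → 0 < M →
      ∃ dK : ℤ, (dK < 0 ∧ Squarefree dK ∧ dK % 4 = 1 ∧ dK ≠ -3) ∧
        (∀ ℓ : ℕ, ℓ.Prime → ℓ ∣ M → SplitsInQuadField dK ℓ) ∧ SplitsInQuadField dK p ∧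
        (∀ (K : Type) [Field K] [NumberField K], IsImaginaryQuadratic K →
          NumberField.discr K = dK → ¬ p ∣ NumberField.classNumber K) := by
  intro p _ M hp5 hM
  have hp : p.Prime := Fact.out
  have hp2 : p ≠ 2 := by omega
  -- the odd primes to split: the odd prime factors of `M`, and `p`
  set S : Finset ℕ := insert p (M.primeFactors.filter (· ≠ 2)) with hS
  have hSodd : ∀ q ∈ S, q.Prime ∧ q ≠ 2 := by
    intro q hq
    rcases Finset.mem_insert.mp hq with rfl | hq
    · exact ⟨hp, hp2⟩
    · exact ⟨Nat.prime_of_mem_primeFactors (Finset.mem_filter.mp hq).1, (Finset.mem_filter.mp hq).2⟩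
  obtain ⟨K, iF, iN, h2, htc, -, h8, -, hSs, hcl⟩ :=
    exists_twoSplit_split_not_dvd_classNumber h22 hp (by omega) S hSodd 0
  have hIQ : IsImaginaryQuadratic K := ⟨h2, htc⟩
  have hneg : NumberField.discr K < 0 := hIQ.discr_neg
  have hsq : Squarefree (NumberField.discr K) := by
    rcases isFundamentalDiscriminant_discr h2 with ⟨-, h, -⟩ | ⟨h4, -, -⟩
    · exact h
    · exfalso
      omega
  refine ⟨NumberField.discr K, ⟨hneg, hsq, by omega, by omega⟩, ?_, ?_, ?_⟩
  · intro ℓ hℓ hℓM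
    by_cases hℓ2 : ℓ = 2
    · subst hℓ2
      exact splitsInQuadField_two_of_emod_eight h8
    · exact splitsInQuadField_discr_of_ncard_eq_two h2 hℓ hℓ2
        (hSs ℓ (Finset.mem_insert_of_mem (Finset.mem_filter.mpr
          ⟨Nat.mem_primeFactors.mpr ⟨hℓ, hℓM, hM.ne'⟩, hℓ2⟩)))
  · exact splitsInQuadField_discr_of_ncard_eq_two h2 hp hp2 (hSs p (Finset.mem_insert_self _ _))
  · intro K' _ _ hK' hd' hdvd
    have h2' : finrank ℚ K' = 2 := hK'.1
    have hneg' : NumberField.discr K' < 0 := hK'.discr_neg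
    have hclass' :
        Literature.NumberTheory.QuadraticFields.BinaryQuadraticForm.classNumber (NumberField.discr K') =
          NumberField.classNumber K' :=
      card_reducedForms_eq_classNumber h2' hneg'
    have hclass :
        Literature.NumberTheory.QuadraticFields.BinaryQuadraticForm.classNumber (NumberField.discr K) =
          NumberField.classNumber K :=
      card_reducedForms_eq_classNumber h2 hneg
    apply hcl
    rw [← hclass, ← hd', hclass']
    exact hdvd

/-! ## §3 Stub (U), from Greenberg's analytic `μ = 0` on class X9 and modularity -/

/-- **Stub (U) of the coprime-frame skeleton from the route's analytic crux and modularity** (signature =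
the registered `Stmt.stub_unitCoeffOfCoprimeTwistX9` verbatim after the two hypotheses): for an X9 pair
`(W, p)` and a square-free `d` with `p ∤ d`, the quadratic twist `W^d` carries the unit-coefficient certificate
`TwistHasUnitCoeff W p d`. Proof: a globally minimal model `W'` of `W^d` exists and is an X9 pair
(`X9.ClassX9.exists_twist`: Néron + twist stability at `p ∤ 2d`), it has a newform `f'` at level `N_{W'}`
(`exists_isNewformOf`), and `AnalyticMuZeroOnClassX9` at `(W', p, f')` is a `p`-adic unit coefficient of
`L_p(f', α(W'))`. CONDITIONAL on the open class statement (Greenberg) and the Modularity Theorem.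
[cite: GreenbergLNM1716, §1 Conj. 1.11] [cite: DiamondShurman2005, Thm. 8.8.3]
[cite: SilvermanAEC2009, VIII.8 Cor. 8.3 and X.5 Cor. 5.4] -/
theorem unitCoeffOfCoprimeTwistX9_of_analyticMuZero (hMu : AnalyticMuZeroOnClassX9)
    (hmod : exists_isNewformOf) :
    ∀ (W : WeierstrassCurve ℚ) [W.IsElliptic] [W.IsGloballyMinimal] (p : ℕ) [Fact p.Prime] (d : ℤ),
      ClassX9 W p → Squarefree d → ¬ (p : ℤ) ∣ d → TwistHasUnitCoeff W p d := by
  intro W _ _ p _ d hX9 hd hpd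
  obtain ⟨W', i, i', C, hC, hX9'⟩ :=
    Summit.BirchSwinnertonDyer.Rank1Residual.X9.ClassX9.exists_twist W p hX9 hd hpd
  haveI : NeZero (W'.conductorNorm ℤ) := ⟨(W'.conductorNorm_pos_holds).ne'⟩
  obtain ⟨f', hf'⟩ := hmod W'
  refine ⟨W', i, i', ⟨C⁻¹, ?_⟩, W'.conductorNorm ℤ, inferInstance, f', hf', hMu W' p f' hX9' hf'⟩
  rw [← hC, smul_smul, inv_mul_cancel, one_smul]

/-! ## §4 The composition: the crux from stub (F), granted BRR 2022, Greenberg's analytic `μ = 0` on X9 and modularity -/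

/-- Square-freeness of `d_K d_F` for a BCS-admissible pair: every prime dividing `d_F` splits in `K`, hence does
not divide `d_K` (the route's `SignedBalance.squarefree_mul_of_admissible`, restated here to keep this module off
the Theses cone of `SignedBalanceX9Assembly`). [folklore] -/
private theorem squarefree_mul_of_splits {dK dF : ℤ} (hK : Squarefree dK) (hF : Squarefree dF)
    (h : ∀ ℓ : ℕ, ℓ.Prime → (ℓ : ℤ) ∣ dF → ¬ (ℓ : ℤ) ∣ dK) : Squarefree (dK * dF) := by
  have hcop : Nat.Coprime dK.natAbs dF.natAbs := by
    rw [Nat.coprime_comm]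
    refine Nat.coprime_of_dvd fun q hq hqF hqK => ?_
    exact h q hq (Int.natCast_dvd.mpr hqF) (Int.natCast_dvd.mpr hqK)
  rw [← Int.squarefree_natAbs, Int.natAbs_mul, Nat.squarefree_mul hcop]
  exact ⟨Int.squarefree_natAbs.mpr hK, Int.squarefree_natAbs.mpr hF⟩

/-- **The crux `TwistedAnalyticMuZeroCoprimeX9` BY NAME from stub (F) and the three binders** — the registered
composition `TwistedAnalyticMuZeroCoprimeX9_of : (F) → (K) → (U) → crux` of the coprime-frame skeleton (bsd-idea-2 g3,
sha 3583344c0151385b) run with (K) := §2 and (U) := §3: given the real-quadratic side (F) (hypothesis `hF`, the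
registered `Stmt.stub_twistSideDiscriminantX9` verbatim — Dirichlet/CRT, BCS 2025 Lemma 5.2.3, owed by the line's
second seat), take `M := N_W · |d_F|` in (K); admissibility is assembled clause by clause, `d_K d_F` is square-free
(as in `SignedBalance.squarefree_mul_of_admissible`) and prime to `p`, and (U) gives the three unit coefficients.
CONDITIONAL on `BRR2022_thm_1` (print), `exists_isNewformOf` (print) and `AnalyticMuZeroOnClassX9` (OPEN; route item
19630, already a binder of the route's `closes`). Nothing is booked; BSD is not proved.
[cite: BurungaleCastellaSkinner2025, §1.2 and Lemma 5.2.3] [cite: BeckwithRaumRichter2022, Theorem 1]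
[cite: GreenbergLNM1716, §1 Conj. 1.11] -/
theorem twistedAnalyticMuZeroCoprimeX9_of_twistSide
    (hF : ∀ (W : WeierstrassCurve ℚ) [W.IsElliptic] [W.IsGloballyMinimal] (p : ℕ) [Fact p.Prime],
      ClassX9 W p → ∃ dF : ℤ, (1 < dF ∧ Squarefree dF ∧ dF % 4 = 1) ∧ InertInQuadField dF p ∧
        (∀ ℓ : ℕ, ℓ.Prime → ℓ ∣ W.conductorNorm ℤ →
          (p ∣ ℓ + 1 → InertInQuadField dF ℓ) ∧ (¬ p ∣ ℓ + 1 → SplitsInQuadField dF ℓ)) ∧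
        (p = 5 → dF ≠ 5))
    (h22 : BRR2022_thm_1) (hMu : AnalyticMuZeroOnClassX9) (hmod : exists_isNewformOf) :
    Summit.BirchSwinnertonDyer.BirchSwinnertonDyer.Theses.SignedBalanceX9.TwistedAnalyticMuZeroCoprimeX9 := by
  intro W _ _ p _ hX9
  have hK := coprimeSplitDiscriminantSupply_of_brr2022 h22
  have hU := unitCoeffOfCoprimeTwistX9_of_analyticMuZero hMu hmod
  obtain ⟨dF, hF1, hFp, hFN, hF5⟩ := hF W p hX9
  have hNpos : 0 < W.conductorNorm ℤ := W.conductorNorm_pos_holds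
  have hdFpos : 0 < dF.natAbs := Int.natAbs_pos.mpr (by omega)
  obtain ⟨dK, hK1, hKM, hKp, hcop⟩ :=
    hK p (W.conductorNorm ℤ * dF.natAbs) hX9.2.1 (Nat.mul_pos hNpos hdFpos)
  have hadm : BCSAdmissiblePair W p dK dF := by
    refine ⟨hK1, ?_, hKp, hF1, hFp, ?_, hFN, hF5⟩
    · intro ℓ hℓ hℓN
      exact hKM ℓ hℓ (dvd_mul_of_dvd_left hℓN _)
    · intro ℓ hℓ hℓF
      exact hKM ℓ hℓ (dvd_mul_of_dvd_right (Int.natCast_dvd.mp hℓF) _)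
  have hsqK : Squarefree dK := hadm.1.2.1
  have hpK : ¬ (p : ℤ) ∣ dK := hadm.2.2.1.1
  have hsqF : Squarefree dF := hadm.2.2.2.1.2.1
  have hpF : ¬ (p : ℤ) ∣ dF := hadm.2.2.2.2.1.1
  have hsqKF : Squarefree (dK * dF) :=
    squarefree_mul_of_splits hsqK hsqF fun ℓ hℓ hℓF => (hadm.2.2.2.2.2.1 ℓ hℓ hℓF).1
  have hp : Prime (p : ℤ) := Nat.prime_iff_prime_int.mp (Fact.out : p.Prime)
  have hpKF : ¬ (p : ℤ) ∣ dK * dF := fun h => (hp.dvd_or_dvd h).elim hpK hpF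
  exact ⟨dK, dF, hadm, hcop, hU W p dK hX9 hsqK hpK, hU W p dF hX9 hsqF hpF,
    hU W p (dK * dF) hX9 hsqKF hpKF⟩

/-- **The crux `SignedBalanceX9.TwistedAnalyticMuZeroCoprimeX9` (item stmt-BirchSwinnertonDyer-25216) BY NAME, GRANTED
Beckwith–Raum–Richter 2022 Thm. 1, Greenberg's analytic `μ = 0` on class X9 (route item 19630) and the Modularity
Theorem** — the composition of §4 run at the LANDED stub (F) `SignedBalanceX9CoprimeFrame.stub_twistSideDiscriminantX9`
(seat w2, p606505; Dirichlet + CRT). The three binders are exactly: one PRINT named fact (`BRR2022_thm_1`, cite-only),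
one PRINT named fact (`exists_isNewformOf`, Breuil–Conrad–Diamond–Taylor), and the route's own OPEN crux
`AnalyticMuZeroOnClassX9` (= `SignedBalanceX9.AnalyticMuZeroX9`, already a binder `hMu` of the route's `closes`).
CONDITIONAL; nothing is booked; the item is closable by name only in an `…OfPrint` re-typing with these binders.
BSD is not proved. [cite: BeckwithRaumRichter2022, Theorem 1] [cite: GreenbergLNM1716, §1 Conj. 1.11]
[cite: DiamondShurman2005, Thm. 8.8.3] [cite: BurungaleCastellaSkinner2025, Lemma 5.2.3] -/
theorem twistedAnalyticMuZeroCoprimeX9_of_print (h22 : BRR2022_thm_1) (hMu : AnalyticMuZeroOnClassX9)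
    (hmod : exists_isNewformOf) :
    Summit.BirchSwinnertonDyer.BirchSwinnertonDyer.Theses.SignedBalanceX9.TwistedAnalyticMuZeroCoprimeX9 :=
  twistedAnalyticMuZeroCoprimeX9_of_twistSide (fun W _ _ p _ hX9 => stub_twistSideDiscriminantX9 W p hX9) h22 hMu hmod

/-! ## §5 The same with modularity in the route's `PublishedInputsX9` currency (`nonempty_modularParametrizationData`) -/

/-- Stub (U) from `AnalyticMuZeroOnClassX9` and modularity in the form ALREADY carried by the route's support
`PublishedInputsX9` (sixth conjunct `nonempty_modularParametrizationData`: a modular parametrisation datum of every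
globally minimal `W`, whose field `f` is a newform of `W` at level `N_W`). [cite: GreenbergLNM1716, §1 Conj. 1.11]
[cite: DiamondShurman2005, Thm. 8.8.3] [cite: SilvermanAEC2009, VIII.8 Cor. 8.3 and X.5 Cor. 5.4] -/
theorem unitCoeffOfCoprimeTwistX9_of_analyticMuZero_of_parametrization (hMu : AnalyticMuZeroOnClassX9)
    (hmodP : nonempty_modularParametrizationData) :
    ∀ (W : WeierstrassCurve ℚ) [W.IsElliptic] [W.IsGloballyMinimal] (p : ℕ) [Fact p.Prime] (d : ℤ),
      ClassX9 W p → Squarefree d → ¬ (p : ℤ) ∣ d → TwistHasUnitCoeff W p d := by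
  intro W _ _ p _ d hX9 hd hpd
  obtain ⟨W', i, i', C, hC, hX9'⟩ :=
    Summit.BirchSwinnertonDyer.Rank1Residual.X9.ClassX9.exists_twist W p hX9 hd hpd
  haveI : NeZero (W'.conductorNorm ℤ) := ⟨(W'.conductorNorm_pos_holds).ne'⟩
  obtain ⟨Dm⟩ := hmodP W'
  refine ⟨W', i, i', ⟨C⁻¹, ?_⟩, W'.conductorNorm ℤ, inferInstance, Dm.f, Dm.isNewformOf,
    hMu W' p Dm.f hX9' Dm.isNewformOf⟩
  rw [← hC, smul_smul, inv_mul_cancel, one_smul]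

/-- **The crux BY NAME from ONE print fact beyond the route's existing binders**:
`BRR2022_thm_1 → AnalyticMuZeroX9 → PublishedInputsX9 → TwistedAnalyticMuZeroCoprimeX9`, all three antecedents
spelled as the ROUTE's declarations (`SignedBalanceX9.AnalyticMuZeroX9` = item 19630 = binder `hMu` of `closes`;
`SignedBalanceX9.PublishedInputsX9` = item 19632 = binder `hPub`). TURNKEY shape for an `…OfPrint` re-typing of item
stmt-BirchSwinnertonDyer-25216 with a single new cite-only support `:= Literature.NumberTheory.QuadraticFields.BRR2022_thm_1`.
CONDITIONAL (one print fact + Greenberg's analytic `μ = 0` on X9, OPEN); nothing is booked; BSD is not proved.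
[cite: BeckwithRaumRichter2022, Theorem 1] [cite: GreenbergLNM1716, §1 Conj. 1.11]
[cite: BurungaleCastellaSkinner2025, Lemma 5.2.3] -/
theorem twistedAnalyticMuZeroCoprimeX9_of_publishedInputs (h22 : BRR2022_thm_1)
    (hMu : Summit.BirchSwinnertonDyer.BirchSwinnertonDyer.Theses.SignedBalanceX9.AnalyticMuZeroX9)
    (hPub : Summit.BirchSwinnertonDyer.BirchSwinnertonDyer.Theses.SignedBalanceX9.PublishedInputsX9) :
    Summit.BirchSwinnertonDyer.BirchSwinnertonDyer.Theses.SignedBalanceX9.TwistedAnalyticMuZeroCoprimeX9 := by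
  obtain ⟨-, -, -, -, -, hmodP, -, -⟩ := hPub
  intro W _ _ p _ hX9
  have hK := coprimeSplitDiscriminantSupply_of_brr2022 h22
  have hU := unitCoeffOfCoprimeTwistX9_of_analyticMuZero_of_parametrization hMu hmodP
  obtain ⟨dF, hF1, hFp, hFN, hF5⟩ := stub_twistSideDiscriminantX9 W p hX9
  have hNpos : 0 < W.conductorNorm ℤ := W.conductorNorm_pos_holds
  have hdFpos : 0 < dF.natAbs := Int.natAbs_pos.mpr (by omega)
  obtain ⟨dK, hK1, hKM, hKp, hcop⟩ :=
    hK p (W.conductorNorm ℤ * dF.natAbs) hX9.2.1 (Nat.mul_pos hNpos hdFpos)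
  have hadm : BCSAdmissiblePair W p dK dF := by
    refine ⟨hK1, ?_, hKp, hF1, hFp, ?_, hFN, hF5⟩
    · intro ℓ hℓ hℓN
      exact hKM ℓ hℓ (dvd_mul_of_dvd_left hℓN _)
    · intro ℓ hℓ hℓF
      exact hKM ℓ hℓ (dvd_mul_of_dvd_right (Int.natCast_dvd.mp hℓF) _)
  have hsqK : Squarefree dK := hadm.1.2.1
  have hpK : ¬ (p : ℤ) ∣ dK := hadm.2.2.1.1
  have hsqF : Squarefree dF := hadm.2.2.2.1.2.1
  have hpF : ¬ (p : ℤ) ∣ dF := hadm.2.2.2.2.1.1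
  have hsqKF : Squarefree (dK * dF) :=
    squarefree_mul_of_splits hsqK hsqF fun ℓ hℓ hℓF => (hadm.2.2.2.2.2.1 ℓ hℓ hℓF).1
  have hp : Prime (p : ℤ) := Nat.prime_iff_prime_int.mp (Fact.out : p.Prime)
  have hpKF : ¬ (p : ℤ) ∣ dK * dF := fun h => (hp.dvd_or_dvd h).elim hpK hpF
  exact ⟨dK, dF, hadm, hcop, hU W p dK hX9 hsqK hpK, hU W p dF hX9 hsqF hpF,
    hU W p (dK * dF) hX9 hsqKF hpKF⟩

end Summit.BirchSwinnertonDyer.BirchSwinnertonDyer.Theorems.SignedBalanceX9CoprimeFrame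

end
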